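import Mathlib
import HarnessLib
import Summits.CriticalPhenomena.PercolationContinuityZ3.Theses.PercTreeValue
import Literature.Probability.Percolation.ClusterBoundary
import Literature.Probability.Percolation.RSW
import Literature.Probability.LatticeModels.LatticeGraph

/-!
# `stub_confOfResNoRoof` of line `SketchIdeator2` (crux `TetrahedronDisjointCoexistence`,
# stmt-CriticalPhenomena-7798): (Res) ∧ (NoRoof) ⇒ (Conf)

Registered stub `stub_confOfResNoRoof` (S6) of the lead's skeleton
`Cruxes/TetrahedronDisjointCoexistence/Lines/SketchIdeator2.lean`, landed DEF-FREE over tree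
declarations.

With `H_r = {x : ℤ³ | 2x₂ + 2 ≤ r}` (the lower half-space `x₂ ≤ (r-2)/2`), its roof layer
`{y ∈ H_r | r < 2y₂ + 4}` (the top layer `y₂ = ⌊(r-2)/2⌋` of `H_r`), and
`P = bondPercolation (zdGraph 3) p` (any `p`):
`P(0 ↔ a in H_r, 0 ↮ roof in H_r) ≤ P(a ∈ C(0) ∧ C(0) ⊆ H_r)`.

Proof.
* Pointwise, for LATTICE configurations `ω ⊆ E(ℤ³)` (`confine_of_openConnIn_of_noRoof`): let `S'`
  be the set of vertices joined to `0` by an open path inside `H_r`. If an open edge `{u, v}` has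
  `u ∈ S'`, then either `v ∈ H_r`, so `v ∈ S'`; or `v ∉ H_r`, and since `u, v` are lattice
  neighbours, `v₂ ≤ u₂ + 1` (`zdGraph_adj_apply_le`), so `2u₂ + 2 ≤ r < 2v₂ + 2 ≤ 2u₂ + 4`, i.e.
  `u` is a roof vertex joined to `0` inside `H_r` — excluded. Hence `S'` is closed under open
  edges, every open walk from `0` stays in `S' ⊆ H_r` (`walk_end_mem_of_closed`), so `C(0) ⊆ H_r`;
  and `a ∈ C(0)` through the induced-subgraph embedding.
* `P`-a.e. `ω ⊆ E(ℤ³)` (`ae_subset_edgeSet`), so the left event is a.e. contained in the right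
  one (`measure_mono_ae`).
-/

noncomputable section

namespace Summit.CriticalPhenomena.PercolationContinuityZ3.Theorems.TetrahedronDisjointCoexistence

open MeasureTheory
open Literature.Probability.Percolation Literature.Probability.LatticeModels

/-- Pointwise form of (Res) ∧ (NoRoof) ⇒ (Conf) for lattice configurations `ω ⊆ E(ℤ³)`: if
`0 ↔ a` inside `H_r = {2x₂ + 2 ≤ r}` and `0` is not joined inside `H_r` to any vertex `y` of the
roof layer `2y₂ + 2 ≤ r < 2y₂ + 4`, then `a ∈ C(0)` and the whole open cluster `C(0)` lies in
`H_r` (the set of vertices joined to `0` inside `H_r` is closed under open lattice edges). -/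
theorem confine_of_openConnIn_of_noRoof (r : ℕ) (a : Site 3) :
    {ω : BondConfig (Site 3) | ω ⊆ (zdGraph 3).edgeSet} ∩
        (openConnIn {x : Site 3 | 2 * x 2 + 2 ≤ (r : ℤ)} 0 a ∩
          {ω | ∀ y : Site 3, 2 * y 2 + 2 ≤ (r : ℤ) → (r : ℤ) < 2 * y 2 + 4 →
              ω ∉ openConnIn {x : Site 3 | 2 * x 2 + 2 ≤ (r : ℤ)} 0 y}) ⊆
      {ω | a ∈ openCluster ω 0 ∧ openCluster ω 0 ⊆ {x : Site 3 | 2 * x 2 + 2 ≤ (r : ℤ)}} := by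
  rintro ω ⟨hωE, hconn, hroof⟩
  set H : Set (Site 3) := {x : Site 3 | 2 * x 2 + 2 ≤ (r : ℤ)} with hH
  -- the vertices joined to `0` by an open path inside `H`
  set S' : Set (Site 3) := {v | ω ∈ openConnIn H 0 v} with hS'
  -- `S'` is closed under the open (lattice) edges of `ω`
  have hcl : ∀ u ∈ S', ∀ v, s(u, v) ∈ ω → u ≠ v → v ∈ S' := by
    intro u hu v huv hne
    obtain ⟨h0, huH, hreach⟩ := hu
    have hadj : (zdGraph 3).Adj u v := (SimpleGraph.mem_edgeSet _).1 (hωE huv)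
    by_cases hvH : v ∈ H
    · refine ⟨h0, hvH, hreach.trans (SimpleGraph.Adj.reachable ?_)⟩
      rw [SimpleGraph.induce_adj]
      exact (openGraph_adj ω u v).2 ⟨huv, hne⟩
    · exfalso
      obtain ⟨h2, -⟩ := zdGraph_adj_apply_le hadj (2 : Fin 3)
      have huH' : 2 * u 2 + 2 ≤ (r : ℤ) := huH
      have hvH' : ¬ 2 * v 2 + 2 ≤ (r : ℤ) := hvH
      exact hroof u huH' (by omega) ⟨h0, huH, hreach⟩
  have h0S : (0 : Site 3) ∈ S' := by
    obtain ⟨h0, -, -⟩ := hconn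
    exact ⟨h0, h0, SimpleGraph.Reachable.refl _⟩
  refine ⟨?_, fun z hz => ?_⟩
  · -- `a ∈ C(0)`: push the path inside `H` to the whole open graph
    obtain ⟨h0, ha, hreach⟩ := hconn
    exact hreach.map (SimpleGraph.Embedding.induce H).toHom
  · -- `C(0) ⊆ H`: every open walk from `0` stays in `S' ⊆ H`
    obtain ⟨w⟩ := (show (openGraph ω).Reachable 0 z from hz)
    obtain ⟨-, hzH, -⟩ := walk_end_mem_of_closed hcl w h0S z w.end_mem_support
    exact hzH

/-- **S6 — (Res) ∧ (NoRoof) ⇒ (Conf).** For `P = bondPercolation (zdGraph 3) p` and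
`H_r = {x | 2x₂ + 2 ≤ r}`: if `0 ↔ a` inside `H_r` and `0` is not joined inside `H_r` to the roof
layer `{y ∈ H_r | r < 2y₂ + 4}`, then (for lattice configurations, a `P`-a.s. event) `a ∈ C(0)` and
the whole cluster `C(0)` lies in `H_r`; hence
`P(0 ↔_{H_r} a, 0 ↮_{H_r} roof) ≤ P(a ∈ C(0) ∧ C(0) ⊆ H_r)`. -/
theorem stub_confOfResNoRoof (p : unitInterval) (r : ℕ) (a : Site 3) :
    (bondPercolation (zdGraph 3) p).real
        (openConnIn {x : Site 3 | 2 * x 2 + 2 ≤ (r : ℤ)} 0 a ∩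
          {ω | ∀ y : Site 3, 2 * y 2 + 2 ≤ (r : ℤ) → (r : ℤ) < 2 * y 2 + 4 →
              ω ∉ openConnIn {x : Site 3 | 2 * x 2 + 2 ≤ (r : ℤ)} 0 y}) ≤
      (bondPercolation (zdGraph 3) p).real
        {ω | a ∈ openCluster ω 0 ∧ openCluster ω 0 ⊆ {x : Site 3 | 2 * x 2 + 2 ≤ (r : ℤ)}} := by
  refine ENNReal.toReal_mono (measure_ne_top _ _) (measure_mono_ae ?_)
  filter_upwards [Literature.Probability.Percolation.ae_subset_edgeSet (zdGraph 3) p] with ω hω hL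
  exact confine_of_openConnIn_of_noRoof r a ⟨hω, hL⟩

end Summit.CriticalPhenomena.PercolationContinuityZ3.Theorems.TetrahedronDisjointCoexistence

end
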